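import Literature.Barriers.CriticalPhenomena.LaceExpansionSAWBootstrap
import Literature.Barriers.CriticalPhenomena.LaceExpansionSAWPiBounds
import Literature.Barriers.CriticalPhenomena.LaceExpansionFourier
import HarnessLib

/-!
# The lace expansion for the self-avoiding walk, VI: Lemma 5.10 (5.37) and Lemma 5.11 —
# the bounds on `Π_z` inside the bootstrap, and the consequences of (3.30)

Barrier catalogue `Literature/Barriers/CriticalPhenomena/` (D-0021); sixth file of the discharge of
`Literature.Barriers.CriticalPhenomena.Slade2006_thm51` (now reduced to `Slade2006_lem516`,
`LaceExpansionSAWBootstrap.lean`). Inputs: the bootstrap frame (`Boot`, `lamOf`, `uBound`),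
Lemma 5.10 (5.38) (`lemma510`), Theorem 4.1 in generating-function form
(`tsum_tsum_piGen_le`, `tsum_tsum_mul_piGen_le`, `tsum_mul_ofReal_abs_lacePi_le`,
`summable_abs_laceCoeff_of_ne_top` — `LaceExpansionSAWPiBounds.lean`), the identity (3.30)
(`latticeFT_twoPoint_mul_eq_one` — `LaceExpansionFourierIdentity.lean`) and the real Fourier
toolkit of `LaceExpansionFourier.lean` (`abs_one_sub_cos_mul_le` = (5.12)/(5.39), `halfNegLap`,
`lintegral_cube_comp_add` = translation invariance, `latticeFT_eq_ofReal_cosFT`).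

## What the source prints (Slade 2006, pp. 67–69)

* Lemma 5.10, (5.37): under `f(z) ≤ K`, `‖[1 - cos(k·x)]H_z(x)‖_∞ ≤ c_K(1+β)Ĉ_{p(z)}(k)⁻¹`, proved via
  (5.39) `‖[1-cos(k·x)]H_z‖_∞ ≤ ½‖Δ_kĜ_z‖₁`, `f₃ ≤ K` and (5.40)
  `‖U_{p(z)}(k,·)‖₁ ≤ 16Ĉ_{p(z)}(k)⁻¹‖Ĉ(·-k)Ĉ(·) + …‖₁ ≤ 16Ĉ(k)⁻¹ 3‖Ĉ_{p(z)}‖₂²` (Cauchy–Schwarz;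
  here `ab ≤ ½(a²+b²)` and translation invariance), with `‖Ĉ‖₂² ≤ 1 + 3β` by (5.8) (here `2 + 8β`).
* Lemma 5.11: `f(z) ≤ 4` ⟹ (5.44) `Σ_x|Π_z^{(N)}(x)| ≤ (c̄β)^N`, (5.45)
  `Σ_x[1-cos(k·x)]|Π_z^{(N)}(x)| ≤ (c̄β)^N Ĉ_{p(z)}(k)⁻¹` — "Proof. This follows immediately from
  Theorem 4.1 and Lemmas 5.10" — and the use made of it on p. 69: `Σ_x|Π_z(x)| ≤ O(β)`,
  `Π̂_z(0) - Π̂_z(k) = O(β)Ĉ(k)⁻¹` ((4.4)), convergence of (3.27) so that (3.29)–(3.30) hold, and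
  `p(z)|Ω| = z|Ω| + Π̂_z(0)` ((5.30) with (3.30) at `k = 0`, used in (5.53)–(5.54)).

## What is formalised (namespace `Literature.Barriers.CriticalPhenomena.SAWLace`)

* `srwGreenFT_sq_le`, `lintegral_srwGreenFT_sq_le` (`∫Ĉ_λ² ≤ (2π)^d(2+8β)`), periodicity and
  `lintegral_srwGreenFT_sq_shift` (`∫Ĉ(l±k)² = ∫Ĉ²`);
* **(5.37)** `one_sub_cos_mul_twoPoint_le`: `[1-cos(k·x)]G_z(x) ≤ 480K(1 - p(z)|Ω|D̂(k))` under
  `Boot d K z`, (5.2), `β ≤ 1` (and its `[0,∞]` form `twoPointENN₁_mul_weight_le`);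
* **Lemma 5.11** `piGen_bounds` / `lemma511` (for `f(z) ≤ 4`, `0 < β ≤ 1/50000`): `Σ_{N,x}Π_z^{(N)}(x) ≤ 10240β`,
  `Σ_{N,x}[1-cos(k·x)]Π_z^{(N)}(x) ≤ 23592960 β (1 - p(z)|Ω|D̂(k))`; hence `Π_z ∈ ℓ¹`,
  `Σ|Π_z| ≤ 10240β`, `Σ[1-cos(k·x)]|Π_z(x)| ≤ 23592960β Ĉ(k)⁻¹`, and summability of `Σ_{m,x}|π_m(x)|z^m`;
* consequences of (3.30): `Fhat d z k = 1 - z|Ω|D̂(k) - Π̂_z(k)`, **`twoPointFT_mul_Fhat`**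
  (`Ĝ_z F̂_z = 1`), `twoPointFT_zero_right` (`Ĝ_z(0) = χ(z)`), `Fhat_zero`, **`lamOf_eq`**
  (`p(z)|Ω| = z|Ω| + Π̂_z(0)`), `abs_cosFT_lacePi_le`, `abs_cosFT_lacePi_zero_sub_le` ((4.4)).
-/

noncomputable section

namespace Literature.Barriers.CriticalPhenomena

namespace SAWLace

open MeasureTheory Finset Filter Real Set Literature.Probability.LatticeModels
  Literature.Probability.LatticeModels.SRW
  Literature.Probability.RandomPlanarGeometry.SAW.Zd Literature.Probability.RandomPlanarGeometry
  Slade2006Prop53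
open scoped BigOperators ENNReal Topology

variable {d : ℕ}

/-! ### `‖Ĉ_λ‖₂²` is bounded: `∫_{[-π,π]^d} Ĉ_λ(l)² dl ≤ (2π)^d (2 + 8β)` -/

/-- `Ĉ_λ = 1 + λD̂Ĉ_λ` (`D̂ < 1`, `λ ∈ [0,1]`). [cite: Slade2006LaceExpansion, eq. (5.10) (first step)] -/
theorem srwGreenFT_eq_one_add {lam : ℝ} (h0 : 0 ≤ lam) (h1 : lam ≤ 1) {k : Fin d → ℝ}
    (hk : srwStepFT d k < 1) :
    srwGreenFT d lam k = 1 + lam * srwStepFT d k * srwGreenFT d lam k := by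
  have hpos := one_sub_mul_srwStepFT_pos h0 h1 hk
  unfold srwGreenFT
  field_simp
  ring

/-- `Ĉ_λ² ≤ 2 + 8 D̂²/(1-D̂)²` pointwise (`D̂ < 1`, `λ ∈ [0,1]`) — a crude form of (5.10) avoiding
Exercise 5.6. [cite: Slade2006LaceExpansion, eq. (5.10)] -/
theorem srwGreenFT_sq_le {lam : ℝ} (h0 : 0 ≤ lam) (h1 : lam ≤ 1) {k : Fin d → ℝ} (hk : srwStepFT d k < 1) :
    srwGreenFT d lam k ^ 2 ≤ 2 + 8 * (srwStepFT d k ^ 2 / (1 - srwStepFT d k) ^ 2) := by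
  have h := srwGreenFT_eq_one_add h0 h1 hk
  have hsq := sq_mul_srwGreenFT_sq_le h0 h1 hk
  have hlam : lam ^ 2 ≤ 1 := by nlinarith
  set C := srwGreenFT d lam k
  set D := srwStepFT d k
  calc C ^ 2 = (1 + lam * D * C) ^ 2 := by rw [← h]
    _ ≤ 2 * 1 ^ 2 + 2 * (lam * D * C) ^ 2 := by nlinarith [sq_nonneg (1 - lam * D * C)]
    _ = 2 + 2 * lam ^ 2 * (D ^ 2 * C ^ 2) := by ring
    _ ≤ 2 + 2 * 1 * (4 * (D ^ 2 / (1 - D) ^ 2)) := by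
        have hDC : 0 ≤ D ^ 2 * C ^ 2 := by positivity
        nlinarith [mul_le_mul hlam hsq hDC zero_le_one]
    _ = _ := by ring

/-- `Ĉ_λ` is continuous for `λ < 1`. [folklore] -/
theorem continuous_srwGreenFT {lam : ℝ} (h0 : 0 ≤ lam) (h1 : lam < 1) :
    Continuous (srwGreenFT d lam) := by
  unfold srwGreenFT
  refine Continuous.inv₀ (continuous_const.sub (continuous_const.mul (continuous_srwStepFT d)))
    fun k => (lt_of_lt_of_le (by linarith) (one_sub_le_one_sub_mul_srwStepFT h0 k)).ne'

/-- `D̂` is `2π`-periodic in each coordinate. [folklore] -/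
theorem srwStepFT_add_twoPi_mul (k : Fin d → ℝ) (n : Fin d → ℤ) :
    srwStepFT d (fun j => k j + 2 * π * n j) = srwStepFT d k := by
  unfold srwStepFT
  congr 1
  exact Finset.sum_congr rfl fun j _ => by
    show Real.cos (k j + 2 * π * n j) = Real.cos (k j)
    rw [show k j + 2 * π * n j = k j + n j * (2 * π) by ring, Real.cos_add_int_mul_two_pi]

/-- **`∫_{[-π,π]^d} Ĉ_λ(l)² dl ≤ (2π)^d (2 + 8β)`** under (5.2) (`λ ∈ [0,1)`; the source's (5.8) gives
`1 + 3β` via Exercise 5.6). [cite: Slade2006LaceExpansion, Lemma 5.5, eq. (5.8)] -/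
theorem lintegral_srwGreenFT_sq_le (hd : 1 ≤ d) {lam β : ℝ} (h0 : 0 ≤ lam) (h1 : lam < 1) (hβ0 : 0 ≤ β)
    (hβ : srwBubbleExcess d ≤ ENNReal.ofReal β) :
    ∫⁻ l in cube d, ENNReal.ofReal (srwGreenFT d lam l ^ 2) ≤ ENNReal.ofReal ((2 * π) ^ d * (2 + 8 * β)) := by
  rw [show (volume.restrict (cube d) : Measure (Fin d → ℝ)) = P d from volume_restrict_cube d]
  calc ∫⁻ l, ENNReal.ofReal (srwGreenFT d lam l ^ 2) ∂P d
      ≤ ∫⁻ l, (ENNReal.ofReal 2 + ENNReal.ofReal 8 *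
          ENNReal.ofReal (srwStepFT d l ^ 2 / (1 - srwStepFT d l) ^ 2)) ∂P d := by
        refine lintegral_mono_ae ?_
        filter_upwards [ae_srwStepFT_lt_one hd] with l hl
        rw [← ENNReal.ofReal_mul (by norm_num), ← ENNReal.ofReal_add (by norm_num) (by positivity)]
        exact ENNReal.ofReal_le_ofReal (srwGreenFT_sq_le h0 h1.le hl)
    _ = ENNReal.ofReal 2 * P d Set.univ +
          ENNReal.ofReal 8 * ∫⁻ l, ENNReal.ofReal (srwStepFT d l ^ 2 / (1 - srwStepFT d l) ^ 2) ∂P d := by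
        rw [lintegral_add_left measurable_const, lintegral_const,
          lintegral_const_mul' _ _ ENNReal.ofReal_ne_top, mul_comm]
    _ ≤ ENNReal.ofReal 2 * ENNReal.ofReal ((2 * π) ^ d) + ENNReal.ofReal 8 * ENNReal.ofReal ((2 * π) ^ d * β) := by
        rw [LaceExpansion.P_univ]
        exact add_le_add le_rfl (mul_le_mul' le_rfl (lintegral_excess_le hβ))
    _ = ENNReal.ofReal ((2 * π) ^ d * (2 + 8 * β)) := by
        rw [← ENNReal.ofReal_mul (by norm_num), ← ENNReal.ofReal_mul (by norm_num),
          ← ENNReal.ofReal_add (by positivity) (by positivity)]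
        congr 1
        ring

/-- The shifted square integrals equal the unshifted one (translation invariance on the torus):
`∫ Ĉ_λ(l - k)² dl = ∫ Ĉ_λ(l + k)² dl = ∫ Ĉ_λ(l)² dl`. [cite: Slade2006LaceExpansion, eq. (5.18)] -/
theorem lintegral_srwGreenFT_sq_shift (lam : ℝ) (k : Fin d → ℝ) :
    ∫⁻ l in cube d, ENNReal.ofReal (srwGreenFT d lam (l - k) ^ 2) =
        ∫⁻ l in cube d, ENNReal.ofReal (srwGreenFT d lam l ^ 2) ∧
      ∫⁻ l in cube d, ENNReal.ofReal (srwGreenFT d lam (l + k) ^ 2) =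
        ∫⁻ l in cube d, ENNReal.ofReal (srwGreenFT d lam l ^ 2) := by
  have hmeas : Measurable fun l => ENNReal.ofReal (srwGreenFT d lam l ^ 2) := by
    unfold srwGreenFT
    exact ((measurable_const.sub (measurable_const.mul (continuous_srwStepFT d).measurable)).inv.pow_const 2).ennreal_ofReal
  have hper : ∀ (l : Fin d → ℝ) (n : Fin d → ℤ),
      ENNReal.ofReal (srwGreenFT d lam (fun j => l j + 2 * π * n j) ^ 2) = ENNReal.ofReal (srwGreenFT d lam l ^ 2) := by
    intro l n
    simp only [srwGreenFT, srwStepFT_add_twoPi_mul]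
  exact ⟨LaceExpansion.lintegral_cube_comp_sub _ hmeas hper k, LaceExpansion.lintegral_cube_comp_add _ hmeas hper k⟩


/-- The real integral `∫_{cube} Ĉ_λ(l + v)² dl ≤ (2π)^d (2 + 8β)` for any shift `v`
(translation invariance + `lintegral_srwGreenFT_sq_le`). [cite: Slade2006LaceExpansion, eqs. (5.18), (5.40)] -/
theorem integral_srwGreenFT_sq_shift_le (hd : 1 ≤ d) {lam β : ℝ} (h0 : 0 ≤ lam) (h1 : lam < 1)
    (hβ0 : 0 ≤ β) (hβ : srwBubbleExcess d ≤ ENNReal.ofReal β) (v : Fin d → ℝ) :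
    ∫ l in cube d, srwGreenFT d lam (l + v) ^ 2 ≤ (2 * π) ^ d * (2 + 8 * β) := by
  have hcont : Continuous fun l => srwGreenFT d lam (l + v) ^ 2 :=
    ((continuous_srwGreenFT h0 h1).comp (continuous_id.add continuous_const)).pow 2
  rw [integral_eq_lintegral_of_nonneg_ae (ae_of_all _ fun l => sq_nonneg _) hcont.aestronglyMeasurable]
  have h := (lintegral_srwGreenFT_sq_shift (d := d) lam v).2
  rw [h]
  have hb := lintegral_srwGreenFT_sq_le hd h0 h1 hβ0 hβ
  calc (∫⁻ l in cube d, ENNReal.ofReal (srwGreenFT d lam l ^ 2)).toReal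
      ≤ (ENNReal.ofReal ((2 * π) ^ d * (2 + 8 * β))).toReal := ENNReal.toReal_mono ENNReal.ofReal_ne_top hb
    _ = (2 * π) ^ d * (2 + 8 * β) := ENNReal.toReal_ofReal (by positivity)

/-! ### Lemma 5.10, (5.37): `‖[1 - cos(k·x)] H_z(x)‖_∞ ≤ c (1+β) Ĉ_{p(z)}(k)⁻¹` from `f₃ ≤ K` -/

/-- **Lemma 5.10, (5.37)**: for `0 < z < z_c`, under `f₃(z) ≤ K` and (5.2) with `β ∈ [0,1]`,
`[1 - cos(k·x)] G_z(x) ≤ 480 K (1 - p(z)|Ω|D̂(k))` for all `k, x` (printed: `c_K(1+β)Ĉ_{p(z)}(k)⁻¹`).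
Proof as printed ((5.39)–(5.40)): `‖[1-cos(k·x)]G_z‖_∞ ≤ ½‖Δ_kĜ_z‖₁` (`abs_one_sub_cos_mul_le`),
`½|Δ_kĜ_z(l)| ≤ K U(k,l)`, `U ≤ 16Ĉ(k)⁻¹(Ĉ(l-k)² + Ĉ(l)² + Ĉ(l+k)²)`, translation invariance and
`‖Ĉ‖₂² ≤ 2 + 8β`. [cite: Slade2006LaceExpansion, Lemma 5.10, eqs. (5.37), (5.39)–(5.40)] -/
theorem one_sub_cos_mul_twoPoint_le (hd : 1 ≤ d) {z : ℝ} (hz : 0 < z) (hzc : z < criticalPoint d)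
    {K β : ℝ} (hβ0 : 0 ≤ β) (hβ1 : β ≤ 1) (hβ : srwBubbleExcess d ≤ ENNReal.ofReal β)
    (hB : Boot d K z) (k : Fin d → ℝ) (x : Site d) :
    (1 - Real.cos (kdot k x)) * twoPoint d 1 z x ≤ 480 * K * (1 - lamOf d z * srwStepFT d k) := by
  have hK0 : 0 ≤ K := le_trans (by positivity) hB.f1
  obtain ⟨hl0, hl1⟩ := lamOf_mem (d := d) hz.le hzc
  set lam := lamOf d z with hlam
  set e := 1 - lam * srwStepFT d k with he
  have he0 : 0 ≤ e := (sub_nonneg.2 hl1.le).trans (one_sub_le_one_sub_mul_srwStepFT hl0 k)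
  have hsum := summable_abs_twoPoint hz hzc
  have heven : Function.Even (twoPoint d 1 z) := fun y => twoPoint_neg z y
  have hpi : (0 : ℝ) < (2 * π) ^ d := by positivity
  -- (5.39)
  have h1 := LaceExpansion.abs_one_sub_cos_mul_le hsum heven k x
  -- the integrand of (5.39) is `|½Δ_kĜ_z(l)| ≤ K U(k,l) ≤ 16 K e (Ĉ(l-k)² + Ĉ(l)² + Ĉ(l+k)²)`
  have hbound : ∀ l, |LaceExpansion.halfNegLap (cosFT (twoPoint d 1 z)) k l| ≤
      16 * K * e * (srwGreenFT d lam (l + -k) ^ 2 + srwGreenFT d lam (l + 0) ^ 2 + srwGreenFT d lam (l + k) ^ 2) := by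
    intro l
    have h3 : |LaceExpansion.halfNegLap (cosFT (twoPoint d 1 z)) k l| ≤ K * uBound d lam k l := hB.f3 k l
    refine h3.trans ?_
    simp only [add_zero, ← sub_eq_add_neg]
    unfold uBound
    have hC := fun m => (srwGreenFT_pos (d := d) hl0 hl1 m).le
    have amgm : srwGreenFT d lam (l - k) * srwGreenFT d lam l + srwGreenFT d lam (l + k) * srwGreenFT d lam l +
        srwGreenFT d lam (l - k) * srwGreenFT d lam (l + k) ≤
        srwGreenFT d lam (l - k) ^ 2 + srwGreenFT d lam l ^ 2 + srwGreenFT d lam (l + k) ^ 2 := by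
      nlinarith [sq_nonneg (srwGreenFT d lam (l - k) - srwGreenFT d lam l),
        sq_nonneg (srwGreenFT d lam (l + k) - srwGreenFT d lam l),
        sq_nonneg (srwGreenFT d lam (l - k) - srwGreenFT d lam (l + k))]
    calc K * (16 * (1 - lam * srwStepFT d k) * (srwGreenFT d lam (l - k) * srwGreenFT d lam l +
          srwGreenFT d lam (l + k) * srwGreenFT d lam l + srwGreenFT d lam (l - k) * srwGreenFT d lam (l + k)))
        ≤ K * (16 * (1 - lam * srwStepFT d k) *
          (srwGreenFT d lam (l - k) ^ 2 + srwGreenFT d lam l ^ 2 + srwGreenFT d lam (l + k) ^ 2)) :=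
          mul_le_mul_of_nonneg_left (mul_le_mul_of_nonneg_left amgm (by positivity)) hK0
      _ = _ := by rw [he]; ring
  -- integrate (5.40)
  have hI : ∫ l in cube d, |LaceExpansion.halfNegLap (cosFT (twoPoint d 1 z)) k l| ≤
      16 * K * e * (3 * ((2 * π) ^ d * (2 + 8 * β))) := by
    have hcC : Continuous (srwGreenFT d lam) := continuous_srwGreenFT hl0 hl1
    have hint : ∀ v : Fin d → ℝ, Integrable (fun l => srwGreenFT d lam (l + v) ^ 2) (volume.restrict (cube d)) := by
      intro v
      rw [LaceExpansion.volume_restrict_cube_eq]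
      refine LaceExpansion.integrable_of_norm_le ((hcC.comp (continuous_id.add continuous_const)).pow 2)
        (C := ((1 - lam)⁻¹) ^ 2) fun l => ?_
      rw [Real.norm_eq_abs, abs_of_nonneg (sq_nonneg _)]
      exact pow_le_pow_left₀ (srwGreenFT_pos hl0 hl1 _).le (srwGreenFT_le_inv hl0 hl1 _) 2
    have hcG : Continuous (twoPointFT d z) := continuous_twoPointFT hz hzc
    have hintL : Integrable (fun l => |LaceExpansion.halfNegLap (cosFT (twoPoint d 1 z)) k l|) (volume.restrict (cube d)) := by
      rw [LaceExpansion.volume_restrict_cube_eq]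
      refine LaceExpansion.integrable_of_norm_le (C := 2 * susceptibility d 1 z) ?_ fun l => ?_
      · exact (LaceExpansion.continuous_halfNegLap (A := twoPointFT d z) hcG k).abs
      · rw [Real.norm_eq_abs, abs_abs]
        exact LaceExpansion.abs_halfNegLap_le (fun m => abs_twoPointFT_le hz.le hzc m) k l
    calc ∫ l in cube d, |LaceExpansion.halfNegLap (cosFT (twoPoint d 1 z)) k l|
        ≤ ∫ l in cube d, 16 * K * e *
            (srwGreenFT d lam (l + -k) ^ 2 + srwGreenFT d lam (l + 0) ^ 2 + srwGreenFT d lam (l + k) ^ 2) :=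
          integral_mono hintL ((((hint (-k)).add (hint 0)).add (hint k)).const_mul _) hbound
      _ = 16 * K * e * ((∫ l in cube d, srwGreenFT d lam (l + -k) ^ 2) + (∫ l in cube d, srwGreenFT d lam (l + 0) ^ 2) +
            ∫ l in cube d, srwGreenFT d lam (l + k) ^ 2) := by
          have h12 : Integrable (fun l => srwGreenFT d lam (l + -k) ^ 2 + srwGreenFT d lam (l + 0) ^ 2)
              (volume.restrict (cube d)) := (hint (-k)).add (hint 0)
          rw [integral_const_mul, integral_add h12 (hint k), integral_add (hint (-k)) (hint 0)]
      _ ≤ 16 * K * e * ((2 * π) ^ d * (2 + 8 * β) + (2 * π) ^ d * (2 + 8 * β) + (2 * π) ^ d * (2 + 8 * β)) := by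
          have hs := fun v => integral_srwGreenFT_sq_shift_le hd hl0 hl1 hβ0 hβ v
          exact mul_le_mul_of_nonneg_left (add_le_add (add_le_add (hs _) (hs _)) (hs _)) (by positivity)
      _ = _ := by ring
  -- conclude
  have hnn : 0 ≤ (1 - Real.cos (kdot k x)) * twoPoint d 1 z x :=
    mul_nonneg (sub_nonneg.2 (Real.cos_le_one _)) (twoPoint_nonneg hz.le x)
  rw [abs_of_nonneg hnn] at h1
  have h2 := h1.trans hI
  have h3 : (2 * π) ^ d * ((1 - Real.cos (kdot k x)) * twoPoint d 1 z x) ≤ (2 * π) ^ d * (480 * K * e) := by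
    refine h2.trans ?_
    have : 16 * K * e * (3 * ((2 * π) ^ d * (2 + 8 * β))) = (2 * π) ^ d * (48 * K * e * (2 + 8 * β)) := by ring
    rw [this]
    refine mul_le_mul_of_nonneg_left ?_ hpi.le
    nlinarith [mul_nonneg hK0 he0]
  exact le_of_mul_le_mul_left h3 hpi

/-- (5.37) in `[0, ∞]`: `H_z(y) · [1 - cos(k·y)] ≤ 480K (1 - p(z)|Ω|D̂(k))` for every `y` (the weight
kills `y = 0`, where `H_z` and `G_z` differ). [cite: Slade2006LaceExpansion, Lemma 5.10, eq. (5.37)] -/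
theorem twoPointENN₁_mul_weight_le (hd : 1 ≤ d) {z : ℝ} (hz : 0 < z) (hzc : z < criticalPoint d)
    {K β : ℝ} (hβ0 : 0 ≤ β) (hβ1 : β ≤ 1) (hβ : srwBubbleExcess d ≤ ENNReal.ofReal β)
    (hB : Boot d K z) (k : Fin d → ℝ) (y : Site d) :
    twoPointENN₁ d z y * ENNReal.ofReal (1 - Real.cos (kdot k y)) ≤
      ENNReal.ofReal (480 * K * (1 - lamOf d z * srwStepFT d k)) := by
  by_cases hy : y = 0
  · subst hy
    rw [twoPointENN₁_zero, zero_mul]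
    exact bot_le
  · have h := one_sub_cos_mul_twoPoint_le hd hz hzc hβ0 hβ1 hβ hB k y
    have hG : twoPointENN₁ d z y = ENNReal.ofReal (twoPoint d 1 z y) := by
      have := twoPointENN_eq_ite_add d z y
      rw [if_neg hy, zero_add] at this
      rw [← this, twoPointENN_eq_ofReal hz hzc]
    rw [hG, ← ENNReal.ofReal_mul (twoPoint_nonneg hz.le y), mul_comm]
    exact ENNReal.ofReal_le_ofReal h


/-! ### Lemma 5.11: the bounds (5.44)–(5.45) on `Π_z` from `f(z) ≤ 4` -/

/-- `[0,∞]` arithmetic: `(c ε) s (1 - c' ε)⁻¹ ≤ 2 c ε s` when `c' ε ≤ ½`. [folklore] -/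
theorem ennreal_geom_le {ε s c c' : ℝ} (hε : 0 ≤ ε) (hs : 0 ≤ s) (hc : 0 ≤ c) (hc' : 0 ≤ c')
    (h : c' * ε ≤ 1 / 2) :
    (ENNReal.ofReal c * ENNReal.ofReal ε) * ENNReal.ofReal s * (1 - ENNReal.ofReal c' * ENNReal.ofReal ε)⁻¹ ≤
      ENNReal.ofReal (2 * c * ε * s) := by
  have hpos : 0 < 1 - c' * ε := by linarith
  rw [← ENNReal.ofReal_mul hc, ← ENNReal.ofReal_mul hc', ← ENNReal.ofReal_one,
    ← ENNReal.ofReal_sub _ (by positivity), ← ENNReal.ofReal_inv_of_pos hpos,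
    ← ENNReal.ofReal_mul (by positivity), ← ENNReal.ofReal_mul (by positivity)]
  refine ENNReal.ofReal_le_ofReal ?_
  have hinv : (1 - c' * ε)⁻¹ ≤ 2 := by
    rw [inv_le_comm₀ hpos (by norm_num)]; linarith
  calc c * ε * s * (1 - c' * ε)⁻¹ ≤ c * ε * s * 2 := mul_le_mul_of_nonneg_left hinv (by positivity)
    _ = 2 * c * ε * s := by ring

/-- The weight `W_k(x) = 1 - cos(k·x)` in `[0,∞]` satisfies the hypotheses of the weighted diagrammatic
bound: `W_k(0) = 0` and `W_k(a) ≤ 2W_k(v) + 2W_k(a - v)` ((5.27)). [cite: Slade2006LaceExpansion, eq. (5.27)] -/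
theorem weight_hyp (k : Fin d → ℝ) :
    (ENNReal.ofReal (1 - Real.cos (kdot k (0 : Site d))) = 0) ∧
      ∀ a v : Site d, ENNReal.ofReal (1 - Real.cos (kdot k a)) ≤
        2 * ENNReal.ofReal (1 - Real.cos (kdot k v)) + 2 * ENNReal.ofReal (1 - Real.cos (kdot k (a - v))) := by
  refine ⟨by simp, fun a v => ?_⟩
  have h := one_sub_cos_le (kdot k a) (kdot k v)
  have hsub : kdot k a - kdot k v = kdot k (a - v) := by
    rw [sub_eq_add_neg a v, Literature.Probability.Percolation.kdot_add,
      Literature.Probability.Percolation.kdot_neg]; ring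
  rw [hsub] at h
  have h1 : 0 ≤ 1 - Real.cos (kdot k v) := sub_nonneg.2 (Real.cos_le_one _)
  have h2 : 0 ≤ 1 - Real.cos (kdot k (a - v)) := sub_nonneg.2 (Real.cos_le_one _)
  calc ENNReal.ofReal (1 - Real.cos (kdot k a))
      ≤ ENNReal.ofReal (2 * (1 - Real.cos (kdot k v)) + 2 * (1 - Real.cos (kdot k (a - v)))) :=
        ENNReal.ofReal_le_ofReal h
    _ = _ := by
        rw [ENNReal.ofReal_add (by positivity) (by positivity), ENNReal.ofReal_mul (by norm_num),
          ENNReal.ofReal_mul (by norm_num), ENNReal.ofReal_ofNat]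

/-- **Lemma 5.11 in `[0,∞]` form**: for `0 < z < z_c` with `f(z) ≤ 4` and (5.2) with
`0 < β ≤ 1/50000`, `Σ_{x,N} Π_z^{(N)}(x) ≤ 10240 β` and
`Σ_{x,N} [1 - cos(k·x)] Π_z^{(N)}(x) ≤ 23592960 β (1 - p(z)|Ω|D̂(k))` (Theorem 4.1 via
`tsum_tsum_piGen_le` / `tsum_tsum_mul_piGen_le`, fed with Lemma 5.10).
[cite: Slade2006LaceExpansion, Lemma 5.11, eqs. (5.44)–(5.45)] -/
theorem piGen_bounds (hd : 1 ≤ d) {z : ℝ} (hz : 0 < z) (hzc : z < criticalPoint d) {β : ℝ}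
    (hβ0 : 0 < β) (hβ1 : β ≤ 1 / 50000) (hβ : srwBubbleExcess d ≤ ENNReal.ofReal β) (hB : Boot d 4 z) :
    (∑' M, ∑' x, piGen d z M x ≤ ENNReal.ofReal (10240 * β)) ∧
      ∀ k : Fin d → ℝ, ∑' M, ∑' x, ENNReal.ofReal (1 - Real.cos (kdot k x)) * piGen d z M x ≤
        ENNReal.ofReal (23592960 * β * (1 - lamOf d z * srwStepFT d k)) := by
  obtain ⟨hl0, hl1⟩ := lamOf_mem (d := d) hz.le hzc
  have h510 := lemma510 hd hz hzc hl0 hl1.le (by norm_num : (1:ℝ) ≤ 4) hB.f1 hB.f2 hβ0.le hβ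
  have hε : (8 : ℝ) * 4 ^ 4 * β = 2048 * β := by norm_num
  rw [hε] at h510
  set ε := 2048 * β with hεdef
  have hε0 : 0 ≤ ε := by positivity
  have hεs : 12 * ε ≤ 1 / 2 := by rw [hεdef]; linarith
  constructor
  · have h := tsum_tsum_piGen_le (d := d) (z := z) h510.1 h510.2
    refine h.trans ?_
    have h1 : ENNReal.ofReal z * (2 * (d : ℝ≥0∞)) * ENNReal.ofReal ε ≤ ENNReal.ofReal (4 * ε) := by
      rw [show (2 * (d : ℝ≥0∞)) = ENNReal.ofReal (2 * d) by
        rw [ENNReal.ofReal_mul (by norm_num), ENNReal.ofReal_ofNat, ENNReal.ofReal_natCast],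
        ← ENNReal.ofReal_mul hz.le, ← ENNReal.ofReal_mul (by positivity)]
      exact ENNReal.ofReal_le_ofReal (mul_le_mul_of_nonneg_right hB.f1 hε0)
    have h2 : ENNReal.ofReal ε * (3 * ENNReal.ofReal ε) * (1 - 3 * ENNReal.ofReal ε)⁻¹ ≤ ENNReal.ofReal ε := by
      have h' := ennreal_geom_le (c := 3) (c' := 3) hε0 hε0 (by norm_num) (by norm_num) (by linarith)
      rw [← ENNReal.ofReal_ofNat 3]
      calc ENNReal.ofReal ε * (ENNReal.ofReal 3 * ENNReal.ofReal ε) * (1 - ENNReal.ofReal 3 * ENNReal.ofReal ε)⁻¹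
          = ENNReal.ofReal 3 * ENNReal.ofReal ε * ENNReal.ofReal ε * (1 - ENNReal.ofReal 3 * ENNReal.ofReal ε)⁻¹ := by ring
        _ ≤ ENNReal.ofReal (2 * 3 * ε * ε) := h'
        _ ≤ ENNReal.ofReal ε := ENNReal.ofReal_le_ofReal (by nlinarith)
    calc _ ≤ ENNReal.ofReal (4 * ε) + ENNReal.ofReal ε := add_le_add h1 h2
      _ = ENNReal.ofReal (10240 * β) := by
          rw [← ENNReal.ofReal_add (by positivity) hε0, hεdef]; ring_nf
  · intro k
    obtain ⟨hW0, hW⟩ := weight_hyp (d := d) k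
    have hs := fun y => twoPointENN₁_mul_weight_le hd hz hzc hβ0.le (by linarith) hβ hB k y
    have h := tsum_tsum_mul_piGen_le (d := d) (z := z) _ hW0 hW h510.1 h510.2 hs
    refine h.trans ?_
    have he0 : 0 ≤ 1 - lamOf d z * srwStepFT d k :=
      (sub_nonneg.2 hl1.le).trans (one_sub_le_one_sub_mul_srwStepFT hl0 k)
    have h' := ennreal_geom_le (c := 3) (c' := 12) hε0 (s := 480 * 4 * (1 - lamOf d z * srwStepFT d k))
      (by positivity) (by norm_num) (by norm_num) hεs
    rw [← ENNReal.ofReal_ofNat 3, ← ENNReal.ofReal_ofNat 12]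
    refine h'.trans (ENNReal.ofReal_le_ofReal (le_of_eq ?_))
    rw [hεdef]; ring

/-- **Lemma 5.11** (consequences of (5.44)–(5.45) for `Π_z = Σ_N (-1)^N Π_z^{(N)}`): for `0 < z < z_c`
with `f(z) ≤ 4` and (5.2) with `0 < β ≤ 1/50000`: `Π_z ∈ ℓ¹` with `Σ_x |Π_z(x)| ≤ 10240 β`,
`Σ_x [1 - cos(k·x)] |Π_z(x)| ≤ 23592960 β Ĉ_{p(z)}(k)⁻¹`, and the double series `Σ_{m,x} |π_m(x)| z^m`
converges (so that (3.29)–(3.30) hold). [cite: Slade2006LaceExpansion, Lemma 5.11] -/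
theorem lemma511 (hd : 1 ≤ d) {z : ℝ} (hz : 0 < z) (hzc : z < criticalPoint d) {β : ℝ}
    (hβ0 : 0 < β) (hβ1 : β ≤ 1 / 50000) (hβ : srwBubbleExcess d ≤ ENNReal.ofReal β) (hB : Boot d 4 z) :
    (Summable fun x => |LaceExpansion.lacePi d 1 z x|) ∧
      (∑' x, |LaceExpansion.lacePi d 1 z x| ≤ 10240 * β) ∧
      (∀ k : Fin d → ℝ, Summable fun x => (1 - Real.cos (kdot k x)) * |LaceExpansion.lacePi d 1 z x|) ∧
      (∀ k : Fin d → ℝ, ∑' x, (1 - Real.cos (kdot k x)) * |LaceExpansion.lacePi d 1 z x| ≤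
        23592960 * β * (1 - lamOf d z * srwStepFT d k)) ∧
      Summable fun p : ℕ × Site d => |LaceExpansion.laceCoeff d 1 p.1 p.2| * z ^ p.1 := by
  obtain ⟨h0, hk⟩ := piGen_bounds hd hz hzc hβ0 hβ1 hβ hB
  obtain ⟨hl0, hl1⟩ := lamOf_mem (d := d) hz.le hzc
  -- generic conversion: `Σ' ofReal (w x |Π x|) ≤ ofReal C` ⟹ summable and `Σ ≤ C`
  have conv : ∀ (w : Site d → ℝ) (C : ℝ), (∀ x, 0 ≤ w x) → 0 ≤ C →
      ∑' x, ENNReal.ofReal (w x) * ENNReal.ofReal |LaceExpansion.lacePi d 1 z x| ≤ ENNReal.ofReal C →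
      (Summable fun x => w x * |LaceExpansion.lacePi d 1 z x|) ∧
        ∑' x, w x * |LaceExpansion.lacePi d 1 z x| ≤ C := by
    intro w C hw hC h
    have h' : ∑' x, ENNReal.ofReal (w x * |LaceExpansion.lacePi d 1 z x|) ≤ ENNReal.ofReal C := by
      simpa only [ENNReal.ofReal_mul (hw _)] using h
    have hne : ∑' x, ENNReal.ofReal (w x * |LaceExpansion.lacePi d 1 z x|) ≠ ⊤ :=
      ne_top_of_le_ne_top ENNReal.ofReal_ne_top h'
    have hsum : Summable fun x => w x * |LaceExpansion.lacePi d 1 z x| := by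
      have := ENNReal.summable_toReal hne
      simpa only [ENNReal.toReal_ofReal (mul_nonneg (hw _) (abs_nonneg _))] using this
    refine ⟨hsum, ?_⟩
    have := ENNReal.toReal_mono ENNReal.ofReal_ne_top h'
    rwa [← ENNReal.ofReal_tsum_of_nonneg (fun x => mul_nonneg (hw x) (abs_nonneg _)) hsum,
      ENNReal.toReal_ofReal (tsum_nonneg fun x => mul_nonneg (hw x) (abs_nonneg _)),
      ENNReal.toReal_ofReal hC] at this
  have hW1 := tsum_mul_ofReal_abs_lacePi_le (d := d) hz.le (fun _ => ENNReal.ofReal 1)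
  simp only [ENNReal.ofReal_one, one_mul] at hW1
  have c1 := conv (fun _ => 1) (10240 * β) (fun _ => zero_le_one) (by positivity)
    (by simpa only [ENNReal.ofReal_one, one_mul] using hW1.trans h0)
  simp only [one_mul] at c1
  have c2 : ∀ k : Fin d → ℝ, (Summable fun x => (1 - Real.cos (kdot k x)) * |LaceExpansion.lacePi d 1 z x|) ∧
      ∑' x, (1 - Real.cos (kdot k x)) * |LaceExpansion.lacePi d 1 z x| ≤
        23592960 * β * (1 - lamOf d z * srwStepFT d k) := by
    intro k
    have he0 : 0 ≤ 1 - lamOf d z * srwStepFT d k :=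
      (sub_nonneg.2 hl1.le).trans (one_sub_le_one_sub_mul_srwStepFT hl0 k)
    exact conv _ _ (fun x => sub_nonneg.2 (Real.cos_le_one _)) (by positivity)
      ((tsum_mul_ofReal_abs_lacePi_le (d := d) hz.le _).trans (hk k))
  exact ⟨c1.1, c1.2, fun k => (c2 k).1, fun k => (c2 k).2,
    summable_abs_laceCoeff_of_ne_top hz.le (ne_top_of_le_ne_top ENNReal.ofReal_ne_top h0)⟩


/-! ### Consequences of (3.30): `F̂_z = 1/Ĝ_z`, `p(z)|Ω| = z|Ω| + Π̂_z(0)` -/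

/-- `Π_z` is even (from `piSigned_neg` and the bridge to `laceCoeff`). [cite: Slade2006LaceExpansion, Prop. 4.2 (ℤ^d-symmetry)] -/
theorem lacePi_neg (z : ℝ) (x : Site d) :
    LaceExpansion.lacePi d 1 z (-x) = LaceExpansion.lacePi d 1 z x := by
  unfold LaceExpansion.lacePi
  refine tsum_congr fun m => ?_
  rw [← piSigned_eq_laceCoeff, ← piSigned_eq_laceCoeff, piSigned_neg]

/-- `F̂_z(k) = 1 - z|Ω|D̂(k) - Π̂_z(k)` ((3.29) for the nearest-neighbour model, `|Ω|D̂(k) = 2Σ_j cos k_j`).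
[cite: Slade2006LaceExpansion, eq. (3.29)] -/
def Fhat (d : ℕ) (z : ℝ) (k : Fin d → ℝ) : ℝ :=
  1 - z * (2 * d) * srwStepFT d k - cosFT (LaceExpansion.lacePi d 1 z) k

/-- **(3.30) in real form**: `Ĝ_z(k) F̂_z(k) = 1` for `0 < z < z_c`, when `Σ_{m,x}|π_m(x)|z^m < ∞`.
[cite: Slade2006LaceExpansion, eq. (3.30)] -/
theorem twoPointFT_mul_Fhat (hd : 1 ≤ d) {z : ℝ} (hz : 0 < z) (hzc : z < criticalPoint d)
    (hπ : Summable fun p : ℕ × Site d => |LaceExpansion.laceCoeff d 1 p.1 p.2| * z ^ p.1)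
    (k : Fin d → ℝ) : twoPointFT d z k * Fhat d z k = 1 := by
  have h := latticeFT_twoPoint_mul_eq_one hz hzc hπ k
  have hP := summable_abs_lacePi hz.le hπ
  rw [latticeFT_twoPoint hz hzc, LaceExpansion.latticeFT_eq_ofReal_cosFT hP (fun x => lacePi_neg z x),
    two_mul_sum_cos_eq hd] at h
  unfold Fhat
  rw [mul_assoc z]
  exact_mod_cast h

/-- `Ĝ_z(0) = χ(z)`. [cite: Slade2006LaceExpansion, eq. (5.30)] -/
theorem twoPointFT_zero_right {z : ℝ} (hz : 0 ≤ z) (hzc : z < criticalPoint d) :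
    twoPointFT d z 0 = susceptibility d 1 z := by
  unfold twoPointFT cosFT
  simp only [kdot_zero_left, Real.cos_zero, one_mul]
  exact (hasSum_twoPoint hz hzc).tsum_eq

/-- `D̂(0) = 1` (`d ≥ 1`). [folklore] -/
theorem srwStepFT_zero (hd : 1 ≤ d) : srwStepFT d 0 = 1 := by
  have hd' : (d : ℝ) ≠ 0 := by exact_mod_cast (show d ≠ 0 by omega)
  simp [srwStepFT, hd']

/-- `F̂_z(0) = 1/χ(z) = 1 - p(z)|Ω|`. [cite: Slade2006LaceExpansion, eq. (5.30)] -/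
theorem Fhat_zero (hd : 1 ≤ d) {z : ℝ} (hz : 0 < z) (hzc : z < criticalPoint d)
    (hπ : Summable fun p : ℕ × Site d => |LaceExpansion.laceCoeff d 1 p.1 p.2| * z ^ p.1) :
    Fhat d z 0 = 1 - lamOf d z := by
  have h := twoPointFT_mul_Fhat hd hz hzc hπ 0
  rw [twoPointFT_zero_right hz.le hzc] at h
  rw [one_sub_lamOf]
  have hχ := (one_le_susceptibility' (d := d) hz.le hzc)
  field_simp at h ⊢
  linarith

/-- **`p(z)|Ω| = z|Ω| + Π̂_z(0)`** ((5.30) combined with (3.30) at `k = 0`).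
[cite: Slade2006LaceExpansion, eqs. (5.30), (5.53)–(5.54)] -/
theorem lamOf_eq (hd : 1 ≤ d) {z : ℝ} (hz : 0 < z) (hzc : z < criticalPoint d)
    (hπ : Summable fun p : ℕ × Site d => |LaceExpansion.laceCoeff d 1 p.1 p.2| * z ^ p.1) :
    lamOf d z = z * (2 * d) + cosFT (LaceExpansion.lacePi d 1 z) 0 := by
  have h := Fhat_zero hd hz hzc hπ
  unfold Fhat at h
  rw [srwStepFT_zero hd] at h
  linarith

/-- `|Π̂_z(k)| ≤ Σ_x |Π_z(x)|`. [folklore] -/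
theorem abs_cosFT_lacePi_le {z : ℝ} (hP : Summable fun x => |LaceExpansion.lacePi d 1 z x|)
    (k : Fin d → ℝ) : |cosFT (LaceExpansion.lacePi d 1 z) k| ≤ ∑' x, |LaceExpansion.lacePi d 1 z x| := by
  unfold cosFT
  have hle : ∀ x, |Real.cos (kdot k x) * LaceExpansion.lacePi d 1 z x| ≤ |LaceExpansion.lacePi d 1 z x| :=
    fun x => by rw [abs_mul]; exact mul_le_of_le_one_left (abs_nonneg _) (abs_cos_le_one _)
  have hs : Summable fun x => ‖Real.cos (kdot k x) * LaceExpansion.lacePi d 1 z x‖ :=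
    hP.of_nonneg_of_le (fun x => norm_nonneg _) fun x => by rw [Real.norm_eq_abs]; exact hle x
  refine (Real.norm_eq_abs _ ▸ norm_tsum_le_tsum_norm hs).trans (Summable.tsum_le_tsum (fun x => ?_) hs hP)
  rw [Real.norm_eq_abs]; exact hle x

/-- `|Π̂_z(0) - Π̂_z(k)| ≤ Σ_x [1 - cos(k·x)] |Π_z(x)|` ((4.4)). [cite: Slade2006LaceExpansion, eq. (4.4)] -/
theorem abs_cosFT_lacePi_zero_sub_le {z : ℝ} (hP : Summable fun x => |LaceExpansion.lacePi d 1 z x|)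
    (k : Fin d → ℝ) :
    |cosFT (LaceExpansion.lacePi d 1 z) 0 - cosFT (LaceExpansion.lacePi d 1 z) k| ≤
      ∑' x, (1 - Real.cos (kdot k x)) * |LaceExpansion.lacePi d 1 z x| := by
  have h1 : Summable fun x => Real.cos (kdot k x) * LaceExpansion.lacePi d 1 z x :=
    hP.of_norm_bounded fun x => by
      rw [Real.norm_eq_abs, abs_mul]; exact mul_le_of_le_one_left (abs_nonneg _) (abs_cos_le_one _)
  have h0 : Summable fun x => Real.cos (kdot (0 : Fin d → ℝ) x) * LaceExpansion.lacePi d 1 z x := by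
    simpa using hP.of_abs
  have hw : Summable fun x => (1 - Real.cos (kdot k x)) * |LaceExpansion.lacePi d 1 z x| :=
    (hP.mul_left 2).of_nonneg_of_le (fun x => mul_nonneg (sub_nonneg.2 (Real.cos_le_one _)) (abs_nonneg _))
      fun x => mul_le_mul_of_nonneg_right (by linarith [Real.neg_one_le_cos (kdot k x)]) (abs_nonneg _)
  unfold cosFT
  rw [← h0.tsum_sub h1]
  have heq : ∀ x, ‖Real.cos (kdot (0 : Fin d → ℝ) x) * LaceExpansion.lacePi d 1 z x -
      Real.cos (kdot k x) * LaceExpansion.lacePi d 1 z x‖ =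
      (1 - Real.cos (kdot k x)) * |LaceExpansion.lacePi d 1 z x| := fun x => by
    rw [Real.norm_eq_abs, kdot_zero_left, Real.cos_zero, one_mul, ← one_sub_mul, abs_mul,
      abs_of_nonneg (sub_nonneg.2 (Real.cos_le_one _))]
  have hs : Summable fun x => ‖Real.cos (kdot (0 : Fin d → ℝ) x) * LaceExpansion.lacePi d 1 z x -
      Real.cos (kdot k x) * LaceExpansion.lacePi d 1 z x‖ := by
    simpa only [heq] using hw
  refine (Real.norm_eq_abs _ ▸ norm_tsum_le_tsum_norm hs).trans (le_of_eq (tsum_congr heq))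

end SAWLace

end Literature.Barriers.CriticalPhenomena
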